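import Mathlib
import HarnessLib
import HarnessLib.Audit
import Summits.KontsevichZagierPeriods.Statement
import Literature.NumberTheory.Transcendental.KZLogCalculus
import HarnessLib.Audit.Status.Attr

/-!
Route: LiouvilleUnfolding

DORMANT since 2026-08-23T21:58:07Z (reconciler: no traction for 6.3 d (last activity item-evidence-added at 2026-08-17T14:41:05Z); parked, not closed — `ledger route dormant route-KontsevichZagierPeriods-LiouvilleUnfolding --off` to rea) — unstaffed, not closed; items shared with open routes are served there. `ledger route dormant <id> --off` reactivates.

# Route LiouvilleUnfolding — KontsevichZagierPeriods (plancard, idea card `liouville-unfolding`,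
2026-08-15)

## Thesis X (it suffices to show X)
Words: logarithms are periods one fibre away (log v = ∫_1^v du/u), so a Newton–Leibniz step whose
primitive is
LOGARITHMIC over the semialgebraic functions — F(x,t) = G(x,t) + Σ_i h_i(x)·log V_i(x,t), G, V_i
ℚ-semialgebraic on
the band, h_i ℚ-semialgebraic on the base — is not a foreign rule: UNFOLDED into one more variable
it is an identity
between honest KZ representations which the four algebraic moves already derive (cylindrical
decomposition with t
last, Newton–Leibniz with the semialgebraic primitive H/u, change of variables u = V(x,t) on
monotonicity cells).
X := LogPrimitiveNL ∧ LogKernelConjecture, where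
 (i)  LogPrimitiveNL (theorem-candidate): for a band rep r = [band, Σ_i h_i ∂_tV_i/V_i] and a base
rep r' =
      [τ, Σ_i h_i (log V_i(·,b) − log V_i(·,a))] that are both KZ.IntegralRep (so both integrands
semialgebraic),
      with V_i > 0 continuous on closed fibres, differentiable on open fibres, termwise absolutely
integrable,
      KZ.of r − KZ.of r' ∈ KZ.relations (the G-part is an ordinary move, WLOG G = 0);
 (ii) LogKernelConjecture (open, summit-strength): ker KZ.eval is contained in every subgroup R ≥
KZ.relations that
      is closed under the logarithmic rule (i) — the period conjecture for the FIVE-rule calculus,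
in which provers
      may integrate with logarithmic antiderivatives.
Lean (elaborates, folder Sketch.lean rc 0; every constant `lean search`ed in KZCalculus.lean /
PeriodConjecture.lean):
  Assembly := LogPrimitiveNL → LogKernelConjecture → KontsevichZagierPeriods
(definitionally the inlined signature filed as item `Assembly`; proof: specialise (ii) at R :=
KZ.relations using (i)
to get Literature.NumberTheory.Transcendental.KZKernelConjecture — this step typechecks in
Sketch.lean — then
Theorems/KernelFormKernelImpliesStatement).
Second layer (informal until the posited object lands): the syntactic logarithmic calculus KZlog
(terms
h₀ + Σ h_i log v_i, termwise integrable, functional-equation rewrite moves, incl : KZ.FormalRep →+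
KZlog.FormalRep,
unfolding ρ) and KZlog.Conservative: incl c ∈ KZlog.relations → c ∈ KZ.relations — the tool that
makes every
"freshman calculus" chain (Fubini + substitution + parts + elementary antiderivatives) admissible
evidence for
positive items of all KontsevichZagierPeriods routes.

Rationale: WHY THIS LINE. Rule 3) of the calculus (KZ.newtonLeibnizRel) demands a ℚ-semialgebraic primitive;
Ayoub2015 Rem. 1.2, Fresan2024 Rem. 3.6 and CressonViusos2022 §2.1 print this as THE obstruction to
"Fubini + Newton–Leibniz" (barrier noSemialgebraicPrimitive_inv_sub_two: log(2−t)).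
Liouville–Rosenlicht (Rosenlicht1976) pins the transcendental shapes of an elementary primitive of
an algebraic function — constants × log(algebraic) — and each is a KZ period FUNCTION of its
argument, so the step UNFOLDS into one more variable (KontsevichZagierPeriods2001 §1.1; §1.2 pp. 8–9
for Calabi's ζ(2)) inside the four moves (BochnakCosteRoy1998 Thm 2.3.1 cylindrical decomposition ×
Baker1975 rigidity at the boundary). STATUS 2026-08-17 (route-choice seat): the theorem-candidate
half of X is PROVED — UnfoldedLogStokes (2835), LogPrimitiveNL (2836), KZlog.Conservative (2953),
both calibrations, Assembly; hence logClosure = KZ.relations and the open core LogKernelConjecture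
(2837) is the summit BY NAME (SpectatorLocalisation.logKernelConjecture_iff_summit, p95927). The
five-rule language has teeth on positive instances only; on 2837 it is inert (STRATEGY-CENSUS.md gen
0+1, Cruxes/LogKernelConjecture/).
RANKED CRUXES. 2 UnfoldedLogStokes ✓. 3 LogPrimitiveNL ✓. 4 LogKernelConjecture — OPEN CORE =
summit; HELD --needs stmt-0540 (negative-lemma/allocation hold; route-choice 2026-08-17: WAIT).
Decomposed EXACTLY along [π]: LogKernelConjecture ↔ AyoubPiLocalKernel ∧ AyoubPiCancellation
(SplitGlue.logKernelConjecture_iff_ayoubPiLocalKernel_and_ayoubPiCancellation; glue item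
LogKernelConjectureSplitGlue 17107 ✓). 5 AyoubPiCancellation (= stmt-0540, crux r2 of
AyoubSpecialisation by rfl; transcendence-free regular-element property; where Ayoub's relative
theorem stops being effective, AyoubRelKZRevisited Rem 1.3; motivic shadow open, HuberWustholz2022
App. A.4) — the live crux with teeth. 6 AyoubPiLocalKernel (= stmt-0541; GPC-strength half after
inverting 2πi, Ayoub2014 Conj. 7, HuberMullerStachPeriods2017 §13.2). RESTATE of 2837 to avoid the
negative lemma's H is void: H = cancellation gap → ¬KontsevichZagierPeriods (Negative/Ideal
not_logKernelConjecture_of_cancellationGap), so every C' in a proved closes inherits H → ¬C'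
(evidence RouteChoice.lean).
KILL CRITERIA. Nothing kills the proved half. A four-rule cancellation gap (route Neg stmt-11011) —
in particular any refutation of AyoubPiCancellation, or of AyoubPiLocalKernel — is an instance of H
and refutes 2837 AND the summit (exact split + negative lemma); the route then closes
refuted:LogKernelConjecture together with every route of the summit. No refutation short of ¬summit
exists for any open item of this route.
NOT DECOMPOSED YET. The formal parent→children edge `--split LogKernelConjecture --into
{AyoubPiLocalKernel, AyoubPiCancellation} --glue-by
Summit.KontsevichZagierPeriods.LiouvilleUnfolding.SplitGlue.logKernelConjectureSplitGlue_proof` is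
ready-to-run (children.json = literal bodies of 0541/0540; glue-by term elaborates at those arrows,
RouteChoice.lean) but bounced for non-final-cycle seats (strategist 2026-08-17T01:11Z, route-choice
seat 01:4xZ): a tenure/final-cycle seat or the operator runs it. No further items: every line/idea
on 2837 is a line on the summit (census); rung-2/rung-ω expansions of the log calculus are
positive-instance tools (LogPrimitiveNL_of, KZlog.Conservative_holds) for other routes' calibration
items, not cruxes here. Do not arm crux-ideate/plan/lead/strategist seats on 2837 again.
CHEAPEST FALSIFIER. For the live pair: a [π]-product certificate that mixes the two disc coordinates
with c's by a change of variables and admits no shadow certificate for c (attack (i) on 0540;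
smallest case c of dimension ≤ 1, where Conjecture 1 for rational reps is PROVED,
PiBox.Dlog.kzConjecture_of_dim_le_one p124986, so a genuine witness needs dim c ≥ 2).

Novelty: Nearest prior work: KontsevichZagierPeriods2001 §1.1 (algebraic integrands → rational by more
variables; log 2 = ∫_1^2 dx/x; Mahler measures) and §1.2 pp. 8–9 (Calabi's ζ(2) substitution
de-transcendentalised by hand); CressonViusos2022 §2.1 (arXiv:1912.01751, held, p. 4: "primitives of
algebraic functions are in general transcendental … out of the algebraic class", example
∫∫_{0<x<1<y<x+1} x/y = ∫ x log(1+x) = 1/4); Ayoub2015 Rem. 1.2/1.5 and Fresan2024 Rem. 3.6–3.7 (same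
obstruction; change of variables recovered from Stokes with one more variable); Viusos2020
(semi-canonical reduction, stays inside algebraic data); Rosenlicht1976 (Liouville structure
theorem, decision layer only). Searched this session: lit search --hybrid, zbMATH (18 works on the
conjecture: none states a conservativity theorem for transcendental-primitive Newton–Leibniz over
the rules), galaxy --star all, CVS full text; plus the card's audit greps (KZ2001, 1509.01097,
1102.2273, 2008.06749, HMS, 1407.2388). Delta: (1) the move-level theorem LogPrimitiveNL /
UnfoldedLogStokes — logarithmic-primitive Newton–Leibniz between algebraic endpoints is DERIVABLE in
the fixed four-move calculus (unfolding × cylindrical decomposition × Baker rigidity), (2) the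
design insight that conservativity of an enlarged calculus is a theorem iff integrands are
identified syntactically (semantic identification = the summit, by collapse of constants). Grade
claimed: new-combination.  [refs: 1912.01751, KontsevichZagierPeriods2001, CressonViusos2022, Ayoub2015, Fresan2024, Viusos2020, Rosenlicht1976]

Barriers (technique_class: primitive-unfolding fibrewise-newton-leibniz conservativity): Literature.Barriers.KontsevichZagierPeriods.noSemialgebraicPrimitive_inv_sub_two: evaded by
construction — the route never asks for a semialgebraic primitive of 1/(t−2); log(2−t) is unfolded
into the fibre {1 ≤ u ≤ 2−t} with integrand 1/u and Newton–Leibniz runs along t with the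
semialgebraic primitive H/u (the barrier's scope caveat "defeats one proof strategy, not a no-go" is
exactly what is exploited); the barrier still blocks variable ELIMINATION, which the route does not
do (it adds a variable).
Literature.Barriers.KontsevichZagierPeriods.kzConjecture_implies_oddZetaAlgIndep: applies verbatim
to crux LogKernelConjecture (summit-strength, admitted open core); does not touch UnfoldedLogStokes
/ LogPrimitiveNL, which assert derivability of VANISHING combinations already known to vanish and
prove no number transcendental.
Literature.Barriers.KontsevichZagierPeriods.kzConjecture_implies_twoPiI_log_algIndep: same — only
the open core LogKernelConjecture inherits it.
Literature.Barriers.KontsevichZagierPeriods.kzConjecture_implies_ellipticPeriods_algIndep: same —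
only LogKernelConjecture inherits it.
Literature.Barriers.KontsevichZagierPeriods.not_complete_of_undecidable: not engaged — no claim that
equality of periods is decidable; Risch/Liouville decide whether a logarithmic MOVE is available, a
side condition, not a value.
Literature.Barriers.KontsevichZagierPeriods.cressonViuSos_prop_3_2: irrelevant — the line uses
dissection (domain additivity) and dimension change (unfold

Novelty grade: new-combination — ROUTE REVIEW gen-2 (refuter, 3rd pass). 6/6 rc0 (W3.lean); Assembly rfl; land KZAssemblyProof (2840). MAJOR STATUS CHANGE missed by gen-1 (12:16–13:12Z, std axioms, W4.lean): (1) defn-KZlog FULFILLED — Literature…Transcendental.KZLogCalculus (syntactic log terms, nine moves incl. log-primitive NL, i (refuter refuter-rreview-route-Langlands-Rational-1dd750bb-g2-0, 2026-08-15T14:33:24Z; prior: KontsevichZagierPeriods2001 §1.1-1.2, arXiv:1912.01751 (CressonViusos2022 §2.1), Ayoub2015 Rem 1.2/1.5, Fresan2024 Rem 3.6, Viusos2020, Rosenlicht1976, Baker1975, BochnakCosteRoy1998 Thm 2.3.1)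

History (route lifecycle, newest last):
- 2026-08-23T21:58:07Z · DORMANT — reconciler: no traction for 6.3 d (last activity item-evidence-added at 2026-08-17T14:41:05Z); parked, not closed — `ledger route dormant route-KontsevichZagier (operator:999:1013150)

sub-problem: KontsevichZagierPeriods · status: dormant · opened planner-plancard-KontsevichZagierPeriods-Kont-825a784d-0 2026-08-15T11:08:57Z · rev 5 · ledger route-KontsevichZagierPeriods-LiouvilleUnfolding
GENERATED by the gate from the ledger (D-0016/17). Provers cite these decls: `theorem foo : Summit.KontsevichZagierPeriods.KontsevichZagierPeriods.Theses.LiouvilleUnfolding.<Decl> := …` in Summits/KontsevichZagierPeriods/KontsevichZagierPeriods/Theorems/<Name>.lean.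
-/

namespace Summit.KontsevichZagierPeriods.KontsevichZagierPeriods.Theses.LiouvilleUnfolding

open scoped BigOperators Topology Manifold Classical MeasureTheory ProbabilityTheory Matrix InnerProductSpace ComplexConjugate ContinuousMap
open Filter Set Function TopologicalSpace MeasureTheory

attribute [summit_statement] _root_.KontsevichZagierPeriods

open Literature Periods

/-- item stmt-KontsevichZagierPeriods-2835 · crux · rank 2 · closed · proved by Summit.KontsevichZagierPeriods.LiouvilleUnfolding.Engine.UnfoldedLogStokes_of @ 1d4b5faf8aec (prover) · by planner
why it might fail: A cell of the cylindrical decomposition may yield an intermediate rep that is not absolutely integrable, or a CoV u=V(x,t) lacking HasFDerivWithinAt on a non-null set; CAD with continuous sections (BCR Thm 2.3.1) is not in tree — heavy. False only if the four moves miss a planar Stokes instance.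
sources: KontsevichZagierPeriods2001, BochnakCosteRoy1998, CressonViusos2022
[crux] The pure-KZ ENGINE of unfolding (no logarithm appears): for ℚ-semialgebraic H, V on a band B
over τ (fibres [a x, b x], V ≥ 1, H and V continuous on closed fibres, t-differentiable on open
fibres with derivatives H', V'), the four honest KZ representations r₁ = [{(x,t,u) : (x,t) ∈ B, 1 ≤
u ≤ V(x,t)}, H'(x,t)/u], r₂ = [{(x,u) : x ∈ τ, 1 ≤ u ≤ V(x,b x)}, H(x,b x)/u], r₃ = the same with a,
r₄ = [B, H·V'/V] satisfy of r₁ − of r₂ + of r₃ + of r₄ ∈ KZ.relations — the unfolding of d/dt (H log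
V) = H' log V + H V'/V integrated over the fibres (eval = 0 by Fubini + FTC, so it is a kernel
element; the item asks for its DERIVATION). Plan: swap (t,u) by a linear CoV; cylindrical
decomposition of {1 ≤ u ≤ V} with t LAST (BochnakCosteRoy1998 Thm 2.3.1: cells C_k of the (x,u)-base
with continuous semialgebraic sections α_k ≤ β_k); on each t-band KZ.newtonLeibnizRel with the
semialgebraic primitive H(x,t)/u; pieces whose section is t = b x (resp. a x) reassemble r₂ (resp.
r₃) by domain additivity; pieces whose section is a root branch of V(x,·) = u are carried by the CoV
(x,t) ↦ (x, V(x,t)) on monotonicity cells (smooth off a null semialgebraic set: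
IsSemialgebraicFunOn.exists_contDiffOn_ho -/
@[route_item "route-KontsevichZagierPeriods-LiouvilleUnfolding"]
def UnfoldedLogStokes : Prop :=
  ∀ (n : ℕ) (τ : Set (Fin n → ℝ)) (a b : (Fin n → ℝ) → ℝ) (H H' V V' : (Fin (n + 1) → ℝ) → ℝ) (r₁ : Literature.NumberTheory.Transcendental.KZ.IntegralRep (n + 2)) (r₂ r₃ r₄ : Literature.NumberTheory.Transcendental.KZ.IntegralRep (n + 1)), Literature.ModelTheory.ExponentialFields.IsSemialgebraic ℚ τ → Literature.NumberTheory.Transcendental.IsSemialgebraicFunOn ℚ τ a → Literature.NumberTheory.Transcendental.IsSemialgebraicFunOn ℚ τ b → (∀ x ∈ τ, a x ≤ b x) → r₄.domain = {z | (Fin.init z : Fin n → ℝ) ∈ τ ∧ a (Fin.init z) ≤ z (Fin.last n) ∧ z (Fin.last n) ≤ b (Fin.init z)} → Literature.NumberTheory.Transcendental.IsSemialgebraicFunOn ℚ r₄.domain H → Literature.NumberTheory.Transcendental.IsSemialgebraicFunOn ℚ r₄.domain V → (∀ z ∈ r₄.domain, 1 ≤ V z) → (∀ x ∈ τ, ContinuousOn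 (fun t : ℝ => H (Fin.snoc x t)) (Set.Icc (a x) (b x)) ∧ ContinuousOn (fun t : ℝ => V (Fin.snoc x t)) (Set.Icc (a x) (b x))) → (∀ x ∈ τ, ∀ t ∈ Set.Ioo (a x) (b x), HasDerivAt (fun s : ℝ => H (Fin.snoc x s)) (H' (Fin.snoc x t)) t ∧ HasDerivAt (fun s : ℝ => V (Fin.snoc x s)) (V' (Fin.snoc x t)) t) → (∀ z ∈ r₄.domain, a (Fin.init z) < z (Fin.last n) → z (Fin.last n) < b (Fin.init z) → r₄.integrand z = H z * V' z / V z) → r₁.domain = {w | (Fin.init w : Fin (n + 1) → ℝ) ∈ r₄.domain ∧ 1 ≤ w (Fin.last (n + 1)) ∧ w (Fin.last (n + 1)) ≤ V (Fin.init w)} → (∀ w ∈ r₁.domain, a (Fin.init (Fin.init w)) < Fin.init w (Fin.last n) → Fin.init w (Fin.last n) < b (Fin.init (Fin.init w)) → r₁.integrand w = H' (Fin.init w) / w (Fin.last (n + 1))) → r₂.domain = {z | (Fin.init z : Fin n → ℝ) ∈ τ ∧ 1 ≤ z (Fin.last n) ∧ z (Fin.last n) ≤ V (Fin.snoc (Fin.init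 z) (b (Fin.init z)))} → (∀ z ∈ r₂.domain, r₂.integrand z = H (Fin.snoc (Fin.init z) (b (Fin.init z))) / z (Fin.last n)) → r₃.domain = {z | (Fin.init z : Fin n → ℝ) ∈ τ ∧ 1 ≤ z (Fin.last n) ∧ z (Fin.last n) ≤ V (Fin.snoc (Fin.init z) (a (Fin.init z)))} → (∀ z ∈ r₃.domain, r₃.integrand z = H (Fin.snoc (Fin.init z) (a (Fin.init z))) / z (Fin.last n)) → Literature.NumberTheory.Transcendental.KZ.of r₁ - Literature.NumberTheory.Transcendental.KZ.of r₂ + Literature.NumberTheory.Transcendental.KZ.of r₃ + Literature.NumberTheory.Transcendental.KZ.of r₄ ∈ Literature.NumberTheory.Transcendental.KZ.relations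

/-- item stmt-KontsevichZagierPeriods-2836 · crux · rank 3 · closed · proved by Summit.KontsevichZagierPeriods.LiouvilleUnfolding.LogPrimitiveNL.LogPrimitiveNL_of (prover) · by planner
why it might fail: r′ semialgebraic forces x ↦ Σ hᵢ(x)·log(Vᵢ(b)/Vᵢ(a)) semialgebraic; the proof needs a rigidity lemma (locally Σ ℚ̄-const·log(alg const), then Baker/Hermite–Lindemann ⇒ 0) unwritten for n ≥ 1 with function coefficients hᵢ; a gap there leaves an underivable boundary residue.
sources: Baker1975, Rosenlicht1976, Ayoub2015, Fresan2024, CressonViusos2022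
[crux] The card's headline at move level: Newton–Leibniz along the last coordinate with a
LOGARITHMIC primitive F(x,t) = Σ_i h_i(x)·log V_i(x,t) (h_i ℚ-semialgebraic on the base τ =
r'.domain, V_i > 0 ℚ-semialgebraic on the band, continuous on closed fibres, differentiable on open
fibres, each h_i ∂_tV_i/V_i absolutely integrable on the band), taken between two honest KZ
representations r = [band, Σ h_i ∂_tV_i/V_i] and r' = [τ, Σ h_i (log V_i(·,b) − log V_i(·,a))], is
derivable: of r − of r' ∈ KZ.relations. (A semialgebraic summand G of the primitive is an ordinary
newtonLeibnizRel move, so WLOG G = 0; r'.integrand semialgebraic is automatic from r' :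
IntegralRep.) Plan: unfold each log V_i into the fibre {1 ≤ u ≤ V_i} (after log v = log max(v,1) −
log max(1/v,1)), apply UnfoldedLogStokes with H = h_i constant in t (so r₁ = 0-integrand); what
remains is the boundary term [τ, Σ h_i log W_i], W_i = V_i(·,b)/V_i(·,a), which is SEMIALGEBRAIC
because r' is a KZ rep: RIGIDITY — on each cell such a function is forced to be Σ (algebraic
const)·log(algebraic const) (log of a non-constant semialgebraic function is not semialgebraic: the
families version of Barriers…noSemialgebraicPrimitive_i -/
@[route_item "route-KontsevichZagierPeriods-LiouvilleUnfolding", crux]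
def LogPrimitiveNL : Prop :=
  ∀ (n k : ℕ) (r : Literature.NumberTheory.Transcendental.KZ.IntegralRep (n + 1)) (r' : Literature.NumberTheory.Transcendental.KZ.IntegralRep n) (a b : (Fin n → ℝ) → ℝ) (h : Fin k → (Fin n → ℝ) → ℝ) (V V' : Fin k → (Fin (n + 1) → ℝ) → ℝ), Literature.NumberTheory.Transcendental.IsSemialgebraicFunOn ℚ r'.domain a → Literature.NumberTheory.Transcendental.IsSemialgebraicFunOn ℚ r'.domain b → (∀ x ∈ r'.domain, a x ≤ b x) → r.domain = {z | (Fin.init z : Fin n → ℝ) ∈ r'.domain ∧ a (Fin.init z) ≤ z (Fin.last n) ∧ z (Fin.last n) ≤ b (Fin.init z)} → (∀ i, Literature.NumberTheory.Transcendental.IsSemialgebraicFunOn ℚ r'.domain (h i)) → (∀ i, Literature.NumberTheory.Transcendental.IsSemialgebraicFunOn ℚ r.domain (V i)) → (∀ i, ∀ z ∈ r.domain, 0 < V i z) → (∀ i, ∀ x ∈ r'.domain, ContinuousOn (fun t : ℝ => V i (Fin.snoc x t)) (Set.Icc (a x) (b x))) → (∀ i, ∀ x ∈ r'.domain, ∀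 t ∈ Set.Ioo (a x) (b x), HasDerivAt (fun s : ℝ => V i (Fin.snoc x s)) (V' i (Fin.snoc x t)) t) → (∀ i, MeasureTheory.IntegrableOn (fun z => h i (Fin.init z) * V' i z / V i z) r.domain) → (∀ x ∈ r'.domain, ∀ t ∈ Set.Ioo (a x) (b x), r.integrand (Fin.snoc x t) = ∑ i, h i x * V' i (Fin.snoc x t) / V i (Fin.snoc x t)) → (∀ x ∈ r'.domain, r'.integrand x = ∑ i, h i x * (Real.log (V i (Fin.snoc x (b x))) - Real.log (V i (Fin.snoc x (a x))))) → Literature.NumberTheory.Transcendental.KZ.of r - Literature.NumberTheory.Transcendental.KZ.of r' ∈ Literature.NumberTheory.Transcendental.KZ.relations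

/-- item stmt-KontsevichZagierPeriods-2837 · crux · rank 4 · open · by planner
why it might fail: It IS the summit (logKernelConjecture_iff_summit, p95927): a four-rule cancellation gap (route Neg 11011; Negative/Ideal not_logKernelConjecture_of_cancellationGap) or any refutation of 0540/0541 refutes it; the oddZeta/twoPiI_log/ellipticPeriods strength barriers apply verbatim.
sources: KontsevichZagierPeriods2001, HuberMullerStachPeriods2017, CressonViusos2022, HuberWustholz2022
[crux] OPEN CORE (summit-strength). The period conjecture for the FIVE-rule calculus: the kernel of
KZ.eval is contained in every subgroup R ≥ KZ.relations closed under the logarithmic Newton–Leibniz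
rule of LogPrimitiveNL (equivalently ker eval ⊆ closure(four moves ∪ log-NL instances); phrased over
R to avoid a second copy of the rule as a set). KZKernelConjecture ⇒ this (trivial: take any R ≥
relations = ker); this ∧ LogPrimitiveNL ⇒ KZKernelConjecture (R := relations) — the Assembly. Its
point: positive instances (every calibration item of every KontsevichZagierPeriods route) may now be
proved with logarithmic antiderivatives; together with the second-layer tool KZlog.Conservative the
admissible evidence becomes all of freshman calculus. Not expected to be proved; refuters read it as
the summit. Sources: KontsevichZagierPeriods2001 §1.2 Conjecture 1; HuberMullerStachPeriods2017
Conj. 13.2.1; CressonViusos2022 §1. -/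
@[route_item "route-KontsevichZagierPeriods-LiouvilleUnfolding", crux]
def LogKernelConjecture : Prop :=
  ∀ (R : AddSubgroup Literature.NumberTheory.Transcendental.KZ.FormalRep), Literature.NumberTheory.Transcendental.KZ.relations ≤ R → (∀ (n k : ℕ) (r : Literature.NumberTheory.Transcendental.KZ.IntegralRep (n + 1)) (r' : Literature.NumberTheory.Transcendental.KZ.IntegralRep n) (a b : (Fin n → ℝ) → ℝ) (h : Fin k → (Fin n → ℝ) → ℝ) (V V' : Fin k → (Fin (n + 1) → ℝ) → ℝ), Literature.NumberTheory.Transcendental.IsSemialgebraicFunOn ℚ r'.domain a → Literature.NumberTheory.Transcendental.IsSemialgebraicFunOn ℚ r'.domain b → (∀ x ∈ r'.domain, a x ≤ b x) → r.domain = {z | (Fin.init z : Fin n → ℝ) ∈ r'.domain ∧ a (Fin.init z) ≤ z (Fin.last n) ∧ z (Fin.last n) ≤ b (Fin.init z)} → (∀ i, Literature.NumberTheory.Transcendental.IsSemialgebraicFunOn ℚ r'.domain (h i)) → (∀ i, Literature.NumberTheory.Transcendental.IsSemialgebraicFunOn ℚ r.domain (V i)) → (∀ i, ∀ z ∈ r.domain,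 0 < V i z) → (∀ i, ∀ x ∈ r'.domain, ContinuousOn (fun t : ℝ => V i (Fin.snoc x t)) (Set.Icc (a x) (b x))) → (∀ i, ∀ x ∈ r'.domain, ∀ t ∈ Set.Ioo (a x) (b x), HasDerivAt (fun s : ℝ => V i (Fin.snoc x s)) (V' i (Fin.snoc x t)) t) → (∀ i, MeasureTheory.IntegrableOn (fun z => h i (Fin.init z) * V' i z / V i z) r.domain) → (∀ x ∈ r'.domain, ∀ t ∈ Set.Ioo (a x) (b x), r.integrand (Fin.snoc x t) = ∑ i, h i x * V' i (Fin.snoc x t) / V i (Fin.snoc x t)) → (∀ x ∈ r'.domain, r'.integrand x = ∑ i, h i x * (Real.log (V i (Fin.snoc x (b x))) - Real.log (V i (Fin.snoc x (a x))))) → Literature.NumberTheory.Transcendental.KZ.of r - Literature.NumberTheory.Transcendental.KZ.of r' ∈ R) → ∀ c : Literature.NumberTheory.Transcendental.KZ.FormalRep, Literature.NumberTheory.Transcendental.KZ.eval c = 0 → c ∈ R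

/-- item stmt-KontsevichZagierPeriods-0540 · crux · rank 5 · open · by planner
why it might fail: A certificate for [π]⋆c may mix the two disc coordinates with c's by a change of variables, leaving no shadow certificate for c; the motivic shadow P̃(MM^eff_Nori)→P̃(MM_Nori) injective is printed OPEN (HuberWustholz2022 App. A.4); one witness is an H-instance and refutes the summit.
sources: HuberWustholz2022, AyoubRelKZRevisited, KontsevichZagierPeriods2001, HuberMullerStachPeriods2017
PiCancellation := ∀ c : Literature.NumberTheory.Transcendental.KZ.FormalRep, (of piRep) ⋆ c ∈
Literature.NumberTheory.Transcendental.KZ.relations → c ∈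
Literature.NumberTheory.Transcendental.KZ.relations, piRep = closed unit disc with integrand 1 (d =
2). A consequence of S (eval (piRep ⋆ c) = π · eval c by Fubini, π ≠ 0), but transcendence-free: it
is a regular-element property of the presented abelian group FormalRep/relations under the product,
and the exact point where Ayoub's relative theorem fails to be effective (AyoubRelKZRevisited Rem
1.3: the torsor exists only over D((2πi)⁻¹)) and where HuberMullerStach2017 §13 passes from P^eff to
P = P^eff[(2πi)⁻¹]. Independent of the chosen π-representation once `relations` is an ideal under ⋆
(part of the def request). Attack suggestions: (i) normal forms for ⋆-multiples of disc reps (the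
disc factor occupies two leading coordinates untouched by NL along the last coordinate; CoV may mix
them — the crux is whether a relation certificate for piRep ⋆ c can be 'projected' to one for c,
e.g. by restricting/fibrewise-specialising the disc coordinates at a rational point and using domain
additivity); (ii) small cases: c supported in dimensi -/
@[route_item "route-KontsevichZagierPeriods-LiouvilleUnfolding", crux]
def AyoubPiCancellation : Prop :=
  ∀ (P : ∀ n : ℕ, Literature.NumberTheory.Transcendental.KZ.IntegralRep n → Literature.NumberTheory.Transcendental.KZ.IntegralRep (n + 2)), (∀ (n : ℕ) (r : Literature.NumberTheory.Transcendental.KZ.IntegralRep n), (P n r).domain = {z : Fin (n + 2) → ℝ | z 0 ^ 2 + z 1 ^ 2 ≤ 1 ∧ (fun i : Fin n => z i.succ.succ) ∈ r.domain} ∧ (P n r).integrand = fun z => r.integrand (fun i : Fin n => z i.succ.succ)) → ∀ c : Literature.NumberTheory.Transcendental.KZ.FormalRep, FreeAbelianGroup.lift (fun s : (Σ n, Literature.NumberTheory.Transcendental.KZ.IntegralRep n) => Literature.NumberTheory.Transcendental.KZ.of (P s.1 s.2)) c ∈ Literature.NumberTheory.Transcendental.KZ.relations → c ∈ Literature.N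umberTheory.Transcendental.KZ.relations

/-- item stmt-KontsevichZagierPeriods-0541 · crux · rank 6 · open · by planner
why it might fail: Period-conjecture strength (Ayoub2014 Cor. 32, HMS Prop. 13.2.6): with π-cancellation it yields algebraic independence of ζ(3), ζ(5), …; torsor methods give relations in Nori's presentation only and their transfer into the four moves (even with [π] inverted) is unproved.
sources: Ayoub2014, HuberMullerStachPeriods2017, AyoubRelKZRevisited, arXiv:1105.0865
PiLocalKernel := ∀ c : Literature.NumberTheory.Transcendental.KZ.FormalRep,
Literature.NumberTheory.Transcendental.KZ.eval c = 0 → ∃ N : ℕ, (of piRep)^⋆N ⋆ c ∈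
Literature.NumberTheory.Transcendental.KZ.relations. This is the half of S reachable by torsor
arguments: Grothendieck's period conjecture gives injectivity of P̃ = P̃^eff[(2πi)⁻¹] → ℂ (route
Grothendieck, 0279), and a transfer of Nori/cohomological relators into KZ.relations (route
NoriTransfer, 0194/0198) then yields (2πi)^{2N}·c = (−4π²)^N·c ∈ relations WITHOUT needing
injectivity of P̃^eff → P̃; Ayoub's rigid-analytic computation of the Betti–de Rham torsor
(Ayoub2015 §3.6, AyoubRelKZRevisited Thm 1.11) is the model argument and works precisely after
inverting 2πi. Open (≈ GPC-strength); filed so that provers/refuters see the effective/localised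
distinction explicitly and so that a proof of #2′ collapses the problem to this item.
[needs_definition: KZ.prodRep / piRep / PiLocalKernel (def request this session); sources:
AyoubRelKZRevisited, Ayoub2015, HuberMullerStach2017] -/
@[route_item "route-KontsevichZagierPeriods-LiouvilleUnfolding", crux]
def AyoubPiLocalKernel : Prop :=
  ∀ (P : ∀ n : ℕ, Literature.NumberTheory.Transcendental.KZ.IntegralRep n → Literature.NumberTheory.Transcendental.KZ.IntegralRep (n + 2)), (∀ (n : ℕ) (r : Literature.NumberTheory.Transcendental.KZ.IntegralRep n), (P n r).domain = {z : Fin (n + 2) → ℝ | z 0 ^ 2 + z 1 ^ 2 ≤ 1 ∧ (fun i : Fin n => z i.succ.succ) ∈ r.domain} ∧ (P n r).integrand = fun z => r.integrand (fun i : Fin n => z i.succ.succ)) → ∀ c : Literature.NumberTheory.Transcendental.KZ.FormalRep, Literature.NumberTheory.Transcendental.KZ.eval c = 0 → ∃ N : ℕ, (⇑(FreeAbelianGroup.lift (fun s : (Σ n, Literature.NumberTheory.Transcendental.KZ.IntegralRep n) => Literature.NumberTheory.Transcendental.KZ.of (P s.1 s.2))))^[N] c ∈ Literature.NumberTheory.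Transcendental.KZ.relations

/-- item stmt-KontsevichZagierPeriods-2953 · support · rank 5 · closed · proved by Summit.KontsevichZagierPeriods.LiouvilleUnfolding.logCalculusConservative_proof @ a92f9d4d8a62 (prover) · by planner
[support until typed; intended crux rank 5 once the posited object KZlog lands — definition request
filed] LogCalculusConservative := Literature.NumberTheory.Transcendental.KZlog.Conservative : ∀ c :
KZ.FormalRep, KZlog.incl c ∈ KZlog.relations → c ∈ KZ.relations. The card's TOOL theorem: a chain of
moves of the logarithmic calculus KZlog (integrands h₀ + Σ h_i·log v_i as SYNTACTIC terms over
ℚ-semialgebraic data, termwise absolutely integrable; moves = domain additivity, term additivity,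
functional-equation rewrites log(vw) = log v + log w / (h+h′) log v / log 1 = 0 / pointwise-equal
coefficients, semialgebraic change of variables, Newton–Leibniz with a logarithmic primitive term
matched by FORMAL differentiation and termwise integrability) that starts and ends at honest KZ
representations is replaced by a chain of the four algebraic moves. Proof plan = retraction (pattern
KZexp.Conservative.of_retraction): the unfolding ρ : KZlog.FormalRep →+ KZ.FormalRep, [σ; h₀; (h_i,
v_i)_i] ↦ [σ, h₀] + Σ_i [{(x,u) : x ∈ σ, 1 ≤ u ≤ v_i x}, h_i(x)/u] (v_i ≥ 1 WLOG via log v = log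
max(v,1) − log max(1/v,1)) satisfies ρ ∘ incl = id on the nose, and ρ(move) ∈ KZ.relations for each
KZlog move: doma -/
@[route_item "route-KontsevichZagierPeriods-LiouvilleUnfolding"]
def LogCalculusConservative : Prop :=
  Literature.NumberTheory.Transcendental.KZlog.Conservative

/-- item stmt-KontsevichZagierPeriods-17107 · support · rank 9 · closed · proved by Summit.KontsevichZagierPeriods.LiouvilleUnfolding.SplitGlue.logKernelConjectureSplitGlue_proof @ 5c4fcf3153e0 (prover) · by planner
[support] STRATEGIST'S DECOMPOSITION of the crux LogKernelConjecture (stmt-2837) along [π] — the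
GLUE: AyoubPiLocalKernel (item 0541, first antecedent, typed by its literal statement) →
AyoubPiCancellation (item 0540, second antecedent, literal statement) → LogKernelConjecture.
PROVABLE NOW and PROVED against the tree: Cruxes/LogKernelConjecture/StrategistSplit.lean
(LogKernelConjecture_of_subs; also the candidate proof scratch-glue.lean against this exact
signature: rc 0, 0 sorry, kernel-closed witness logKernelConjectureSplitGlue_proof) — proof =
logKernelConjecture_iff_kzKernelConjecture (p95927) ∘
KernelForm.LocaliseAtValuePrime.kernelForm_iff_ayoubPiLocalKernel_and_ayoubPiCancellation (p121847).
A planner cannot land Theorems files: any prover may copy the 6-line proof to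
Theorems/LiouvilleUnfoldingLogKernelConjectureSplit.lean. The split is EXACT
(LogKernelConjecture_iff_subs in StrategistSplit.lean), so with this glue 2837 is decided BY the two
existing staffed items 0541 ∧ 0540; the formal parent→children edge (route edit --split
LogKernelConjecture --into children.json --glue-by <landed glue>) bounced for this seat only on the
final-cycle rule and is ready for the tenure p -/
@[route_item "route-KontsevichZagierPeriods-LiouvilleUnfolding", crux]
def LogKernelConjectureSplitGlue : Prop :=
  (∀ (P : ∀ n : ℕ, Literature.NumberTheory.Transcendental.KZ.IntegralRep n → Literature.NumberTheory.Transcendental.KZ.IntegralRep (n + 2)), (∀ (n : ℕ) (r : Literature.NumberTheory.Transcendental.KZ.IntegralRep n), (P n r).domain = {z : Fin (n + 2) → ℝ | z 0 ^ 2 + z 1 ^ 2 ≤ 1 ∧ (fun i : Fin n => z i.succ.succ) ∈ r.domain} ∧ (P n r).integrand = fun z => r.integrand (fun i : Fin n => z i.succ.succ)) → ∀ c : Literature.NumberTheory.Transcendental.KZ.FormalRep, Literature.NumberTheory.Transcendental.KZ.eval c = 0 → ∃ N : ℕ, (⇑(FreeAbelianGroup.lift (fun s : (Σ n, Literature.NumberTheory.Transcendental.KZ.IntegralRep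 n) => Literature.NumberTheory.Transcendental.KZ.of (P s.1 s.2))))^[N] c ∈ Literature.NumberTheory.Transcendental.KZ.relations) → (∀ (P : ∀ n : ℕ, Literature.NumberTheory.Transcendental.KZ.IntegralRep n → Literature.NumberTheory.Transcendental.KZ.IntegralRep (n + 2)), (∀ (n : ℕ) (r : Literature.NumberTheory.Transcendental.KZ.IntegralRep n), (P n r).domain = {z : Fin (n + 2) → ℝ | z 0 ^ 2 + z 1 ^ 2 ≤ 1 ∧ (fun i : Fin n => z i.succ.succ) ∈ r.domain} ∧ (P n r).integrand = fun z => r.integrand (fun i : Fin n => z i.succ.succ)) → ∀ c : Literature.NumberTheory.Transcendental.KZ.FormalRep, FreeAbelianGroup.lift (fun s : (Σ n, Literature.NumberTheory.Transcendental.KZ.IntegralRep n) => Literature.NumberTheory.Transcendental.KZ.of (P s.1 s.2)) c ∈ Literature.NumberTheory.Transcendental.KZ.relations → c ∈ Literature.NumberTheory.Transcendental.KZ.relations) → LogKernelConjecture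

/-- item stmt-KontsevichZagierPeriods-2838 · support · rank 9 · closed · proved by Summit.KontsevichZagierPeriods.LiouvilleUnfolding.Calibration.CVSQuarter_proof (prover) · by planner
sources: CressonViusos2022
[support] Calibration = the card's unit test (CressonViusos2022 §2.1, held text p. 4):
∫∫_{0<x<1<y<x+1} x/y dy dx = ∫₀¹ x·log(1+x) dx = 1/4, as KZ.Equivalent of the 2-dim rational rep and
the 0-dim constant 1/4. In the log calculus: two NL moves through the NON-KZ intermediate [(0,1), x
log(1+x)]. Pure-KZ proof found by unfolding (planner, on paper): the given rep IS the unfolding of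
x·log(1+x); swap coordinates (linear CoV, x last): domain {1<u<2, u−1<x<1}, integrand x/u =
∂ₓ((x²−1)/(2u)); NL along x with the semialgebraic primitive (x²−1)/(2u) gives [(1,2), 1 − u/2]; NL
with primitive u − u²/4 gives the constant 1/4 (value (2−1) − (1−1/4)). Three moves + side
conditions (HasFDerivWithinAt/InjOn of the swap, band shape, IsSemialgebraicFunOn of the
primitives). Numerics: 0.2500000000 (midpoint rule, 2·10⁵ nodes). -/
@[route_item "route-KontsevichZagierPeriods-LiouvilleUnfolding"]
def CVSQuarter : Prop :=
  ∀ (r : Literature.NumberTheory.Transcendental.KZ.IntegralRep 2) (r' : Literature.NumberTheory.Transcendental.KZ.IntegralRep 0), r.domain = {z | 0 < z 0 ∧ z 0 < 1 ∧ 1 < z 1 ∧ z 1 < z 0 + 1} → Set.EqOn r.integrand (fun z => z 0 / z 1) r.domain → r'.domain = Set.univ → Set.EqOn r'.integrand (fun _ => 1 / 4) r'.domain → Literature.NumberTheory.Transcendental.KZ.Equivalent r r'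

/-- item stmt-KontsevichZagierPeriods-2839 · support · rank 9 · closed · proved by Summit.KontsevichZagierPeriods.LiouvilleUnfolding.Catalan.CatalanTwoWays_proof (prover) · by planner
sources: KontsevichZagierPeriods2001
[support] Calibration (card): Catalan's constant two ways, [(0,1)², 1/(1+x²y²)] ~ [(0,1)²,
1/(2√((1−y²)(1−x²y²)))]; values ∫₀¹ arctan(y)/y dy = G and ∫₀¹ arcsin(y)/(2y√(1−y²)) dy = ½∫₀^{π/2}
θ/sin θ dθ = G = 0.9159655942 (both checked to 1e−11). Textbook proofs pass through arctan/arcsin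
primitives and θ = 2 arctan t; UNFOLDED, no transcendental function survives and the planner's paper
proof is four algebraic changes of variables in dimension 2: (x,y) ↦ (u = xy, y) on the first rep
gives U = [{0<u<y<1}, 1/(y(1+u²))]; (x,y) ↦ (s = xy, y) on the second gives [{0<s<y<1},
1/(2y√((1−y²)(1−s²)))]; then y = 2t/(1+t²) (dy/(2y√(1−y²)) = dt/(2t), arcsin-free) gives [{0<t<1,
0<s<2t/(1+t²)}, 1/(2t√(1−s²))]; finally the fibrewise Weierstrass map s = 2u/(1+u²) (ds/(2√(1−s²)) =
du/(1+u²), u ∈ (0,t)) lands exactly on U. Side conditions: injectivity/derivatives of the four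
semialgebraic maps, absolute integrability (log-singularity of K at k → 1 is integrable). Sources:
KontsevichZagierPeriods2001 §1.1 (G-type examples); card liouville-unfolding. -/
@[route_item "route-KontsevichZagierPeriods-LiouvilleUnfolding"]
def CatalanTwoWays : Prop :=
  ∀ (r r' : Literature.NumberTheory.Transcendental.KZ.IntegralRep 2), r.domain = {z | 0 < z 0 ∧ z 0 < 1 ∧ 0 < z 1 ∧ z 1 < 1} → Set.EqOn r.integrand (fun z => 1 / (1 + z 0 ^ 2 * z 1 ^ 2)) r.domain → r'.domain = {z | 0 < z 0 ∧ z 0 < 1 ∧ 0 < z 1 ∧ z 1 < 1} → Set.EqOn r'.integrand (fun z => 1 / (2 * Real.sqrt ((1 - z 1 ^ 2) * (1 - z 0 ^ 2 * z 1 ^ 2)))) r'.domain → Literature.NumberTheory.Transcendental.KZ.Equivalent r r'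

/-- item stmt-KontsevichZagierPeriods-2840 · assembly · rank 1 · closed · proved by Summit.KontsevichZagierPeriods.LiouvilleUnfolding.assembly_proof (prover) · by planner
sources: KontsevichZagierPeriods2001
[assembly] LogPrimitiveNL → LogKernelConjecture → KontsevichZagierPeriods (the signature is the two
crux signatures inlined, definitionally equal to that arrow — checked by `rfl` in the planner's
Sketch.lean). Proof: given c with KZ.eval c = 0, apply LogKernelConjecture at R := KZ.relations
(le_rfl, closure under the log rule = LogPrimitiveNL) to get c ∈ KZ.relations, i.e.
Literature.NumberTheory.Transcendental.KZKernelConjecture (this λ-term typechecks in Sketch.lean);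
then Theorems/KernelFormKernelImpliesStatement.lean (kernel form ⇒ statement, proved) or
kzKernelConjecture_iff_isRational. One-screen proof; calibration for the
FreeAbelianGroup/AddSubgroup API. -/
@[route_item "route-KontsevichZagierPeriods-LiouvilleUnfolding"]
def Assembly : Prop :=
  (∀ (n k : ℕ) (r : Literature.NumberTheory.Transcendental.KZ.IntegralRep (n + 1)) (r' : Literature.NumberTheory.Transcendental.KZ.IntegralRep n) (a b : (Fin n → ℝ) → ℝ) (h : Fin k → (Fin n → ℝ) → ℝ) (V V' : Fin k → (Fin (n + 1) → ℝ) → ℝ), Literature.NumberTheory.Transcendental.IsSemialgebraicFunOn ℚ r'.domain a → Literature.NumberTheory.Transcendental.IsSemialgebraicFunOn ℚ r'.domain b → (∀ x ∈ r'.domain, a x ≤ b x) → r.domain = {z | (Fin.init z : Fin n → ℝ) ∈ r'.domain ∧ a (Fin.init z) ≤ z (Fin.last n) ∧ z (Fin.last n) ≤ b (Fin.init z)} → (∀ i, Literature.NumberTheory.Transcendental.IsSemialgebraicFunOn ℚ r'.domain (h i)) → (∀ i, Literature.NumberTheory.Transcendental.IsSemialgebraicFunOn ℚ r.domain (V i))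 → (∀ i, ∀ z ∈ r.domain, 0 < V i z) → (∀ i, ∀ x ∈ r'.domain, ContinuousOn (fun t : ℝ => V i (Fin.snoc x t)) (Set.Icc (a x) (b x))) → (∀ i, ∀ x ∈ r'.domain, ∀ t ∈ Set.Ioo (a x) (b x), HasDerivAt (fun s : ℝ => V i (Fin.snoc x s)) (V' i (Fin.snoc x t)) t) → (∀ i, MeasureTheory.IntegrableOn (fun z => h i (Fin.init z) * V' i z / V i z) r.domain) → (∀ x ∈ r'.domain, ∀ t ∈ Set.Ioo (a x) (b x), r.integrand (Fin.snoc x t) = ∑ i, h i x * V' i (Fin.snoc x t) / V i (Fin.snoc x t)) → (∀ x ∈ r'.domain, r'.integrand x = ∑ i, h i x * (Real.log (V i (Fin.snoc x (b x))) - Real.log (V i (Fin.snoc x (a x))))) → Literature.NumberTheory.Transcendental.KZ.of r - Literature.NumberTheory.Transcendental.KZ.of r' ∈ Literature.NumberTheory.Transcendental.KZ.relations) → (∀ (R : AddSubgroup Literature.NumberTheory.Transcendental.KZ.FormalRep), Literature.NumberTheory.Transcendental.KZ.relations ≤ R → (∀ (n k : ℕ) (r : Literature.NumberTheory.Transcendental.KZ.IntegralRep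 (n + 1)) (r' : Literature.NumberTheory.Transcendental.KZ.IntegralRep n) (a b : (Fin n → ℝ) → ℝ) (h : Fin k → (Fin n → ℝ) → ℝ) (V V' : Fin k → (Fin (n + 1) → ℝ) → ℝ), Literature.NumberTheory.Transcendental.IsSemialgebraicFunOn ℚ r'.domain a → Literature.NumberTheory.Transcendental.IsSemialgebraicFunOn ℚ r'.domain b → (∀ x ∈ r'.domain, a x ≤ b x) → r.domain = {z | (Fin.init z : Fin n → ℝ) ∈ r'.domain ∧ a (Fin.init z) ≤ z (Fin.last n) ∧ z (Fin.last n) ≤ b (Fin.init z)} → (∀ i, Literature.NumberTheory.Transcendental.IsSemialgebraicFunOn ℚ r'.domain (h i)) → (∀ i, Literature.NumberTheory.Transcendental.IsSemialgebraicFunOn ℚ r.domain (V i)) → (∀ i, ∀ z ∈ r.domain, 0 < V i z) → (∀ i, ∀ x ∈ r'.domain, ContinuousOn (fun t : ℝ => V i (Fin.snoc x t)) (Set.Icc (a x) (b x))) → (∀ i, ∀ x ∈ r'.domain, ∀ t ∈ Set.Ioo (a x) (b x), HasDerivAt (fun s : ℝ => V i (Fin.snoc x s)) (V' i (Fin.snoc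 x t)) t) → (∀ i, MeasureTheory.IntegrableOn (fun z => h i (Fin.init z) * V' i z / V i z) r.domain) → (∀ x ∈ r'.domain, ∀ t ∈ Set.Ioo (a x) (b x), r.integrand (Fin.snoc x t) = ∑ i, h i x * V' i (Fin.snoc x t) / V i (Fin.snoc x t)) → (∀ x ∈ r'.domain, r'.integrand x = ∑ i, h i x * (Real.log (V i (Fin.snoc x (b x))) - Real.log (V i (Fin.snoc x (a x))))) → Literature.NumberTheory.Transcendental.KZ.of r - Literature.NumberTheory.Transcendental.KZ.of r' ∈ R) → ∀ c : Literature.NumberTheory.Transcendental.KZ.FormalRep, Literature.NumberTheory.Transcendental.KZ.eval c = 0 → c ∈ R) → KontsevichZagierPeriods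

/-! D-0027 §2.1 — DECIDING THEOREM (planner-authored via `route open/edit --closes-file`; by planner-rchoice-KontsevichZagierPeriods-Liouvi-9f96c2d4-0 2026-08-17T01:31:10Z):
its hypotheses are this route's items and its conclusion the sub-problem Statement (glue_lint), and it elaborates with this file. -/

@[closes "route-KontsevichZagierPeriods-LiouvilleUnfolding"] theorem closes (h₁ : LogPrimitiveNL) (h₂ : LogKernelConjectureSplitGlue) (h₃ : AyoubPiLocalKernel)
    (h₄ : AyoubPiCancellation) : KontsevichZagierPeriods := by
  intro n m r r' _ _ hv
  have hK : ∀ c : Literature.NumberTheory.Transcendental.KZ.FormalRep,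
      Literature.NumberTheory.Transcendental.KZ.eval c = 0 →
        c ∈ Literature.NumberTheory.Transcendental.KZ.relations :=
    (h₂ h₃ h₄) Literature.NumberTheory.Transcendental.KZ.relations le_rfl h₁
  apply hK
  simp [Literature.NumberTheory.Transcendental.KZ.eval_of, hv]

end Summit.KontsevichZagierPeriods.KontsevichZagierPeriods.Theses.LiouvilleUnfolding
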